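import Literature.RepresentationTheory.FiniteGroups.SymmetricGroupCosetSpanProofs
import Literature.Barriers.PneNP.TSPExtensionComplexityMatchings
import HarnessLib

/-!
# Functions on `𝔖ₙ` invariant under the pair-swaps of a perfect matching have no Fourier
# component at partitions with more than `n/2` rows

The "transposition trick" (Fulton–Harris, *Representation Theory*, Lemma 4.23 (1) and its
proof; James, LNM 682, §4): if a group-algebra element `a` satisfies `a · (p q) = a` for a
transposition `(p q)` and `g⁻¹ p, g⁻¹ q` lie in one column of the canonical tableau `T_μ`, then
`a · g · b_μ = a · g · (g⁻¹(p q)g) · b_μ = - a · g · b_μ`, so `a g b_μ = 0`.  If `a` is invariant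
under the `n/2` disjoint transpositions of a perfect matching `P` and `μ` has MORE than `n/2`
rows, then for every `g` two entries of the first column of `g T_μ` fall into one pair of `P`
(pigeonhole), hence `a · ℂ[𝔖ₙ] · b_μ = 0`, `a · S^μ = 0` (`S^μ = ℂ[𝔖ₙ] a_μ b_μ`), i.e. the
Fourier transform `f̂([μ]) = Σ_σ f(σ) ρ_μ(σ)` of a function `f` right-invariant under the
pair-swaps of `P` vanishes at every `μ` with `μ'₁ > |P| = n/2`
(`fourierSpecht_eq_zero_of_pairInvariant`).  This is the "long first column" half of the Fourier
support computation for functions on perfect matchings (the number of first-column entries is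
`μ'₁ = μ.transpose.parts.sup`, see `StandardTableauxDichotomy.lean`; cell pnp-psdrank, rung route
`EquivariantThetaLift`, crux `InvariantSubspaceLowDegree`; companion of
`FourierVanishingSmallDim.lean`).

## References

* W. Fulton, J. Harris, *Representation Theory. A First Course*, GTM 129, Lemma 4.23 (1) and
  proof (the transposition trick). [FultonHarrisGTM129]
* G. D. James, *The Representation Theory of the Symmetric Groups*, LNM 682, §4 (Lemma 4.6).
  [JamesLNM682]
-/

noncomputable section

open scoped BigOperators

namespace Literature.RepresentationTheory.FiniteGroups

open Literature.NumberTheory.DiophantineGeometry Literature.Barriers.PneNP Finset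

variable {n : ℕ}

/-- The group-algebra element `a_f = Σ_σ f(σ) σ`. [cite: FultonHarrisGTM129, §3.4 (group algebra)] -/
def algElt (f : Equiv.Perm (Fin n) → ℂ) : MonoidAlgebra ℂ (Equiv.Perm (Fin n)) :=
  ∑ σ, f σ • MonoidAlgebra.of ℂ _ σ

/-- `f̂([μ]) x = a_f · x` in `S^μ ⊆ ℂ[𝔖ₙ]`. [cite: FultonHarrisGTM129, §3.4] -/
theorem coe_fourierSpecht_apply (f : Equiv.Perm (Fin n) → ℂ) (μ : Nat.Partition n)
    (x : spechtIdeal ℂ μ) :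
    ((fourierSpecht f μ x : spechtIdeal ℂ μ) : MonoidAlgebra ℂ (Equiv.Perm (Fin n))) =
      algElt f * (x : MonoidAlgebra ℂ (Equiv.Perm (Fin n))) := by
  rw [fourierSpecht, LinearMap.sum_apply, Submodule.coe_sum, algElt, Finset.sum_mul]
  refine Finset.sum_congr rfl fun σ _ => ?_
  rw [LinearMap.smul_apply, Submodule.coe_smul_of_tower, spechtRep_apply, smul_mul_assoc]

/-- Right invariance under a transposition: `a_f · (p q) = a_f`.
[cite: FultonHarrisGTM129, Lemma 4.23 (1) (proof)] -/
theorem algElt_mul_of_swap {f : Equiv.Perm (Fin n) → ℂ} {p q : Fin n}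
    (hf : ∀ σ, f (σ * Equiv.swap p q) = f σ) :
    algElt f * MonoidAlgebra.of ℂ _ (Equiv.swap p q) = algElt f := by
  rw [algElt, Finset.sum_mul]
  simp_rw [smul_mul_assoc, ← map_mul]
  -- reindex `σ ↦ σ (p q)`
  rw [← (Fintype.sum_bijective (fun σ => σ * Equiv.swap p q) (Group.mulRight_bijective _) _ _
    fun σ => rfl)]
  refine Finset.sum_congr rfl fun σ _ => ?_
  rw [hf, mul_assoc, Equiv.swap_mul_self, mul_one]

/-- **The transposition trick**: if `a (p q) = a`, `p ≠ q`, and `g⁻¹ p, g⁻¹ q` lie in one column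
of `T_μ`, then `a · g · b_μ = 0`. [cite: FultonHarrisGTM129, Lemma 4.23 (1) (proof)] -/
theorem mul_of_mul_colAntisymmetrizer_eq_zero {a : MonoidAlgebra ℂ (Equiv.Perm (Fin n))}
    {μ : Nat.Partition n} {g : Equiv.Perm (Fin n)} {p q : Fin n} (hpq : p ≠ q)
    (ha : a * MonoidAlgebra.of ℂ _ (Equiv.swap p q) = a)
    (hcol : μ.colOf (g⁻¹ p) = μ.colOf (g⁻¹ q)) :
    a * MonoidAlgebra.of ℂ _ g * colAntisymmetrizer ℂ μ = 0 := by
  set X := a * MonoidAlgebra.of ℂ _ g * colAntisymmetrizer ℂ μ with hX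
  have ht' : Equiv.swap (g⁻¹ p) (g⁻¹ q) ∈ colStabilizer μ := swap_mem_colStabilizer μ hcol
  have hsgn : Equiv.Perm.sign (Equiv.swap (g⁻¹ p) (g⁻¹ q)) = -1 :=
    Equiv.Perm.sign_swap (g⁻¹.injective.ne hpq)
  have hneg : X = -X := by
    calc X = a * MonoidAlgebra.of ℂ _ (Equiv.swap p q) * MonoidAlgebra.of ℂ _ g *
          colAntisymmetrizer ℂ μ := by rw [ha]
      _ = a * MonoidAlgebra.of ℂ _ g *
          (MonoidAlgebra.of ℂ _ (Equiv.swap (g⁻¹ p) (g⁻¹ q)) * colAntisymmetrizer ℂ μ) := by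
          rw [mul_assoc a, ← map_mul, Equiv.swap_mul_eq_mul_swap, map_mul]
          simp only [mul_assoc]
      _ = -X := by
          rw [of_mul_colAntisymmetrizer ht', hsgn, Units.val_neg, Units.val_one, Int.cast_neg,
            Int.cast_one, mul_smul_comm, neg_smul, one_smul]
  have h2 : (2 : ℂ) • X = 0 := by
    rw [two_smul]
    nth_rewrite 2 [hneg]
    exact add_neg_cancel X
  calc X = (2 : ℂ)⁻¹ • ((2 : ℂ) • X) := (inv_smul_smul₀ two_ne_zero X).symm
    _ = 0 := by rw [h2, smul_zero]

/-- **Pair-swap invariance kills the Fourier transform at partitions with more than `n/2` rows.**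
If `f : 𝔖ₙ → ℂ` satisfies `f(σ (p q)) = f(σ)` for every pair `{p,q}` of a perfect matching `P` of
`[n]` and the first column of the canonical tableau of `μ ⊢ n` has more than `|P|` entries
(`μ'₁ > |P|`), then `f̂([μ]) = 0`.
[cite: FultonHarrisGTM129, Lemma 4.23 (1) (proof)] [cite: JamesLNM682, §4] -/
theorem fourierSpecht_eq_zero_of_pairInvariant (P : Finset (Sym2 (Fin n))) (hP : IsPMOn univ P)
    (f : Equiv.Perm (Fin n) → ℂ)
    (hf : ∀ p q : Fin n, s(p, q) ∈ P → ∀ σ, f (σ * Equiv.swap p q) = f σ)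
    (μ : Nat.Partition n) (hμ : P.card < (univ.filter fun j : Fin n => μ.colOf j = 0).card) :
    fourierSpecht f μ = 0 := by
  classical
  -- every point lies in a pair of `P`
  have hcov : ∀ x : Fin n, ∃ e ∈ P, x ∈ e := by
    intro x
    have h1 := hP.2.2 x (mem_univ x)
    obtain ⟨e, he⟩ := Finset.card_eq_one.1 h1
    have : e ∈ P.filter fun e => x ∈ e := by rw [he]; exact mem_singleton_self e
    exact ⟨e, (mem_filter.1 this).1, (mem_filter.1 this).2⟩
  choose φ hφP hφx using hcov
  -- key: `a_f · g · b_μ = 0` for every `g`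
  have key : ∀ g : Equiv.Perm (Fin n),
      algElt f * MonoidAlgebra.of ℂ _ g * colAntisymmetrizer ℂ μ = 0 := by
    intro g
    obtain ⟨j, hj, j', hj', hjj', hφ⟩ := Finset.exists_ne_map_eq_of_card_lt_of_maps_to hμ
      (f := fun j => φ (g j)) fun j _ => hφP (g j)
    have hne : g j ≠ g j' := g.injective.ne hjj'
    have hmem : s(g j, g j') ∈ P := by
      have h := (Sym2.mem_and_mem_iff hne).1 ⟨hφx (g j), hφ ▸ hφx (g j')⟩
      rw [← h]; exact hφP (g j)
    refine mul_of_mul_colAntisymmetrizer_eq_zero hne (algElt_mul_of_swap (hf _ _ hmem)) ?_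
    simp only [Equiv.Perm.coe_inv, Equiv.symm_apply_apply]
    rw [(mem_filter.1 hj).2, (mem_filter.1 hj').2]
  -- extend to `a_f · z · b_μ = 0`
  have key' : ∀ z : MonoidAlgebra ℂ (Equiv.Perm (Fin n)),
      algElt f * z * colAntisymmetrizer ℂ μ = 0 := by
    intro z
    induction z using MonoidAlgebra.induction_on with
    | hM g => exact key g
    | hadd x y hx hy => rw [mul_add, add_mul, hx, hy, add_zero]
    | hsmul c x hx => rw [mul_smul_comm, smul_mul_assoc, hx, smul_zero]
  -- conclude on `S^μ = ℂ[𝔖ₙ] a_μ b_μ`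
  refine LinearMap.ext fun x => Subtype.ext ?_
  rw [coe_fourierSpecht_apply, LinearMap.zero_apply, Submodule.coe_zero]
  obtain ⟨z, hz⟩ := Ideal.mem_span_singleton'.1 x.2
  have h := key' (z * rowSymmetrizer ℂ μ)
  rw [mul_assoc, mul_assoc] at h
  rw [← hz, youngSymmetrizer]
  exact h

end Literature.RepresentationTheory.FiniteGroups
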